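import Mathlib.Analysis.SpecialFunctions.Pow.Real
import Mathlib.Algebra.BigOperators.Intervals
import Mathlib.Algebra.Order.BigOperators.Group.Finset
import Mathlib.Data.Finset.Max
import Mathlib.MeasureTheory.Measure.Real
import Literature.Probability.LatticeModels.ProdBernoulliIndependence
import Literature.Probability.Percolation.NetworkReliabilityCuts
import Literature.Probability.Percolation.NetworkReliabilityCutsProofs
import HarnessLib

/-!
# Large cuts rarely fail — proof of Karger's Theorem 2.9 (`Karger1999_largeCutFailure_holds`)

Discharges the named fact `Literature.Probability.Percolation.Karger1999_largeCutFailure`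
(`NetworkReliabilityCuts.lean`; Karger 1999, Thm. 2.9): in the bundle model
`prodBernoulli (bundleOpenWeight m p)` of a multigraph on `n` vertices with minimum cut `c ≥ 1`,
`p^c = n^{-(2+δ)}`, `δ > 0`: (i) `P(some cut fails) ≤ n^{-δ}(1 + 2/δ)` and (ii) for every real
`α ≥ 1`, `P(some cut of value ≥ αc fails) ≤ n^{-αδ}(1 + 2/δ)`.

## The printed proof and how it is followed

Karger 1999 (SIAM J. Comput. 29; arXiv cs/9809012 §2.3), proof of Thm. 2.9: "For the graph to become
disconnected, all the edges in some cut must fail. We therefore bound the failure probability by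
summing the probabilities that each cut fails. Let `c_1 ≤ c_2 ≤ ⋯` be the values of the cuts in
increasing order … `p_k = p^{c_k}` …  the first `n^{2α}` cuts … have `p_k ≤ (p^c)^{α}`;  by the
cut-counting theorem `c_k > (ln k / 2 ln n)·c`, so `p_k < k^{-(1+δ/2)}` and
`Σ_{k > n^{2α}} p_k ≤ ∫_{n^{2α}}^∞ k^{-(1+δ/2)} dk = 2n^{-αδ}/δ`."  Here:

* `prodBernoulli_real_cutFails` — a cut of value `v` fails with probability exactly `p^v`
  (cylinder probability `prodBernoulli_real_forall_notMem` of the crossing bundles; the pairs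
  `(x,y) ∈ S × Sᶜ` inject into `Sym2`);
* `real_exists_cutFails_le_sum` — the union bound, over ANCHORED cuts `S ∋ v` (both sides of a cut
  give the same event, `cutFails_compl`);
* the sorting `c_1 ≤ c_2 ≤ ⋯` is replaced by the RANK `#{S' : value S' ≤ value S}` and the
  majorisation lemma `sum_rank_le` (an antitone function of the rank sums to at most `Σ_{k ≤ K} φ(k)`);
* `sum_anchored_pow_le` — the estimate `p^{value S} ≤ min(N^{-s}, rank(S)^{-s})`, `N = n^{2α}`,
  `s = 1 + δ/2`, from `Karger1999_cutCounting_holds` applied at `α' = value S / c`, and then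
  `sum_min_rpow_le`: `Σ_{k ≥ 1} min(N^{-s}, k^{-s}) ≤ N^{1-s}(1 + 1/(s-1)) = n^{-αδ}(1 + 2/δ)`.
  DEVIATION: the integral `∫ k^{-s} dk` is replaced by the elementary inequality
  `(b-a)b^{-s} ≤ (a^{1-s} - b^{1-s})/(s-1)` (`sub_mul_rpow_neg_le`, from `log u ≤ u - 1 ≤ e^{u-1}-1`),
  used both for the telescoping tail (`sum_Icc_rpow_neg_le`) and — since `n^{2α}` need not be an
  integer, a point the printed proof glosses over — for the comparison between `N` and `⌊N⌋ + 1`;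
  the printed constant `1 + 2/δ` is recovered exactly.
* (i) is (ii) at `α = 1` (every cut has value `≥ c`).

## Contents

* namespace `Karger1999`: `sub_mul_rpow_neg_le`, `sum_Icc_rpow_neg_le`, `sum_min_rpow_le`,
  `sum_rank_le`, `cutFails_compl`, `prodBernoulli_real_cutFails`, `real_exists_cutFails_le_sum`,
  `sum_anchored_pow_le`, `largeCutFailure_of_cutCounting : Karger1999_cutCounting →
  Karger1999_largeCutFailure`;
* `Karger1999_largeCutFailure_holds : Karger1999_largeCutFailure`.

Not here: `LomonosovPolesskii1972_cycleComparison` (Karger's Lemma 4.7) remains a named fact.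
-/

noncomputable section

open Finset MeasureTheory
open Literature.Probability.LatticeModels (prodBernoulli prodBernoulli_real_forall_notMem)

namespace Literature.Probability.Percolation

namespace Karger1999


/-! ### Two elementary substitutes for `∫ x^{-s} dx` -/

/-- For `0 < a ≤ b` and `s > 1`: `(b-a)·b^{-s} ≤ (a^{1-s} - b^{1-s})/(s-1)` (the integral
`∫_a^b x^{-s} dx` is at least `(b-a)` times the smallest value of the integrand; proved from
`log u ≤ u - 1` and `1 + x ≤ exp x`). [folklore] -/
theorem sub_mul_rpow_neg_le {a b s : ℝ} (ha : 0 < a) (hab : a ≤ b) (hs : 1 < s) :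
    (b - a) * b ^ (-s) ≤ (a ^ (1 - s) - b ^ (1 - s)) / (s - 1) := by
  have hb : 0 < b := lt_of_lt_of_le ha hab
  have hu : 0 < a / b := div_pos ha hb
  have key : 1 + (s - 1) * (1 - a / b) ≤ (a / b) ^ (1 - s) := by
    rw [Real.rpow_def_of_pos hu]
    have h1 : Real.log (a / b) ≤ a / b - 1 := Real.log_le_sub_one_of_pos hu
    have h2 : (s - 1) * (1 - a / b) ≤ Real.log (a / b) * (1 - s) := by nlinarith
    calc 1 + (s - 1) * (1 - a / b) ≤ Real.log (a / b) * (1 - s) + 1 := by linarith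
      _ ≤ Real.exp (Real.log (a / b) * (1 - s)) := Real.add_one_le_exp _
  have hbs : 0 < b ^ (1 - s) := Real.rpow_pos_of_pos hb _
  have hdiv : (a / b) ^ (1 - s) * b ^ (1 - s) = a ^ (1 - s) := by
    rw [Real.div_rpow ha.le hb.le, div_mul_cancel₀ _ hbs.ne']
  have hbms : b ^ (-s) = b ^ (1 - s) / b := by
    rw [← Real.rpow_sub_one hb.ne']; ring_nf
  have hmul := mul_le_mul_of_nonneg_right key hbs.le
  rw [hdiv] at hmul
  rw [le_div_iff₀ (by linarith : (0 : ℝ) < s - 1), hbms]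
  have hid : (b - a) * (b ^ (1 - s) / b) * (s - 1) = (s - 1) * (1 - a / b) * b ^ (1 - s) := by
    field_simp
  rw [hid]
  nlinarith

/-- Telescoping: `Σ_{k=M}^{K} k^{-s} ≤ M^{-s} + (M^{1-s} - K^{1-s})/(s-1)` for `1 ≤ M ≤ K`, `s > 1`.
[folklore] -/
theorem sum_Icc_rpow_neg_le {M : ℕ} (hM : 1 ≤ M) {s : ℝ} (hs : 1 < s) :
    ∀ K, M ≤ K → ∑ k ∈ Icc M K, (k : ℝ) ^ (-s)
      ≤ (M : ℝ) ^ (-s) + ((M : ℝ) ^ (1 - s) - (K : ℝ) ^ (1 - s)) / (s - 1) := by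
  intro K hK
  induction K, hK using Nat.le_induction with
  | base => simp
  | succ K hK ih =>
    rw [Finset.sum_Icc_succ_top (by omega)]
    have hK0 : (0 : ℝ) < K := by exact_mod_cast (show 0 < K by omega)
    have hstep := sub_mul_rpow_neg_le hK0 (by linarith : (K : ℝ) ≤ K + 1) hs
    have hcast : ((K + 1 : ℕ) : ℝ) = (K : ℝ) + 1 := by push_cast; ring
    rw [hcast]
    have h1 : ((K : ℝ) + 1 - K) * ((K : ℝ) + 1) ^ (-s) = ((K : ℝ) + 1) ^ (-s) := by ring
    rw [h1] at hstep
    have hsplit : ((M : ℝ) ^ (1 - s) - ((K : ℝ) + 1) ^ (1 - s)) / (s - 1)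
        = ((M : ℝ) ^ (1 - s) - (K : ℝ) ^ (1 - s)) / (s - 1)
          + ((K : ℝ) ^ (1 - s) - ((K : ℝ) + 1) ^ (1 - s)) / (s - 1) := by ring
    rw [hsplit]
    linarith

/-- `Σ_{k=1}^{K} min(N^{-s}, k^{-s}) ≤ N^{1-s}·(1 + 1/(s-1))` for real `N ≥ 1`, `s > 1` and every `K`
(Karger 1999, proof of Thm. 2.9: the first `n^{2α}` terms are `≤ N^{-s}`, the tail is
`≤ ∫_{N}^∞ k^{-s} dk = N^{1-s}/(s-1)`; here with the integrality of the cut index handled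
exactly). [cite: Karger1999, Thm. 2.9 (proof)] -/
theorem sum_min_rpow_le {N s : ℝ} (hN : 1 ≤ N) (hs : 1 < s) (K : ℕ) :
    ∑ k ∈ Ioc 0 K, min (N ^ (-s)) ((k : ℝ) ^ (-s)) ≤ N ^ (1 - s) * (1 + 1 / (s - 1)) := by
  have hN0 : 0 < N := by linarith
  set F : ℕ := ⌊N⌋₊ with hF
  have hFN : (F : ℝ) ≤ N := Nat.floor_le hN0.le
  have hNF : N < (F : ℝ) + 1 := Nat.lt_floor_add_one N
  have hF1 : 1 ≤ F := by
    rw [hF]; exact Nat.one_le_floor_iff _ |>.2 hN |> fun h => h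
  -- split the sum at F
  have hsplit : ∑ k ∈ Ioc 0 K, min (N ^ (-s)) ((k : ℝ) ^ (-s))
      ≤ (∑ k ∈ (Ioc 0 K).filter (fun k => k ≤ F), N ^ (-s))
        + ∑ k ∈ (Ioc 0 K).filter (fun k => ¬ k ≤ F), (k : ℝ) ^ (-s) := by
    rw [← Finset.sum_filter_add_sum_filter_not (Ioc 0 K) (fun k => k ≤ F)]
    exact add_le_add (Finset.sum_le_sum fun k _ => min_le_left _ _)
      (Finset.sum_le_sum fun k _ => min_le_right _ _)
  have h1 : (∑ k ∈ (Ioc 0 K).filter (fun k => k ≤ F), N ^ (-s)) ≤ (F : ℝ) * N ^ (-s) := by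
    rw [Finset.sum_const, nsmul_eq_mul]
    have hcard : ((Ioc 0 K).filter (fun k => k ≤ F)).card ≤ F := by
      calc ((Ioc 0 K).filter (fun k => k ≤ F)).card ≤ (Ioc 0 F).card := by
            refine Finset.card_le_card fun k hk => ?_
            simp only [mem_filter, mem_Ioc] at hk ⊢
            omega
        _ = F := by simp
    exact mul_le_mul_of_nonneg_right (by exact_mod_cast hcard) (Real.rpow_nonneg hN0.le _)
  have h2 : ∑ k ∈ (Ioc 0 K).filter (fun k => ¬ k ≤ F), (k : ℝ) ^ (-s)
      ≤ ((F : ℝ) + 1) ^ (-s) + ((F : ℝ) + 1) ^ (1 - s) / (s - 1) := by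
    by_cases hKM : F + 1 ≤ K
    · have hset : (Ioc 0 K).filter (fun k => ¬ k ≤ F) = Icc (F + 1) K := by
        ext k; simp only [mem_filter, mem_Ioc, mem_Icc]; omega
      rw [hset]
      have := sum_Icc_rpow_neg_le (by omega : 1 ≤ F + 1) hs K hKM
      have hcast : ((F + 1 : ℕ) : ℝ) = (F : ℝ) + 1 := by push_cast; ring
      rw [hcast] at this
      have hK0 : (0 : ℝ) ≤ (K : ℝ) ^ (1 - s) := Real.rpow_nonneg (by positivity) _
      have hs0 : (0 : ℝ) < s - 1 := by linarith
      have : (((F : ℝ) + 1) ^ (1 - s) - (K : ℝ) ^ (1 - s)) / (s - 1)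
          ≤ ((F : ℝ) + 1) ^ (1 - s) / (s - 1) :=
        div_le_div_of_nonneg_right (by linarith) hs0.le
      linarith
    · have hset : (Ioc 0 K).filter (fun k => ¬ k ≤ F) = ∅ := by
        ext k; simp only [mem_filter, mem_Ioc, Finset.notMem_empty, iff_false]; omega
      rw [hset, Finset.sum_empty]
      have hs0 : (0 : ℝ) < s - 1 := by linarith
      positivity
  -- the key comparison between N and M = F + 1
  have hkey := sub_mul_rpow_neg_le hN0 hNF.le hs
  have hMN : ((F : ℝ) + 1) ^ (-s) ≤ N ^ (-s) :=
    Real.rpow_le_rpow_of_nonpos hN0 hNF.le (by linarith)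
  have hN1s : N ^ (1 - s) = N * N ^ (-s) := by
    rw [sub_eq_add_neg, Real.rpow_add hN0, Real.rpow_one]
  have hs0 : (0 : ℝ) < s - 1 := by linarith
  have hnn : 0 ≤ N - F := by linarith
  have hprod : 0 ≤ (N - F) * (N ^ (-s) - ((F : ℝ) + 1) ^ (-s)) :=
    mul_nonneg hnn (by linarith)
  have hdiv : ((F : ℝ) + 1) ^ (1 - s) / (s - 1)
      ≤ N ^ (1 - s) / (s - 1) - ((F : ℝ) + 1 - N) * ((F : ℝ) + 1) ^ (-s) := by
    have : ((F : ℝ) + 1 - N) * ((F : ℝ) + 1) ^ (-s) ≤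
        (N ^ (1 - s) - ((F : ℝ) + 1) ^ (1 - s)) / (s - 1) := hkey
    have e : (N ^ (1 - s) - ((F : ℝ) + 1) ^ (1 - s)) / (s - 1)
        = N ^ (1 - s) / (s - 1) - ((F : ℝ) + 1) ^ (1 - s) / (s - 1) := by ring
    linarith
  calc ∑ k ∈ Ioc 0 K, min (N ^ (-s)) ((k : ℝ) ^ (-s))
      ≤ (F : ℝ) * N ^ (-s) + (((F : ℝ) + 1) ^ (-s) + ((F : ℝ) + 1) ^ (1 - s) / (s - 1)) :=
        hsplit.trans (add_le_add h1 h2)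
    _ ≤ N * N ^ (-s) + N ^ (1 - s) / (s - 1) := by nlinarith
    _ = N ^ (1 - s) * (1 + 1 / (s - 1)) := by rw [hN1s]; ring

/-! ### Majorisation along ranks -/

/-- If `φ` is antitone on the positive integers, then summing `φ` of the RANK
`#{S' ∈ A : val S' ≤ val S}` over `S ∈ A` gives at most `Σ_{k=1}^{|A|} φ(k)` (sorting the cuts by
value, Karger 1999, proof of Thm. 2.9: "let `c_1 ≤ c_2 ≤ ⋯` be the values of the cuts in
increasing order"). [cite: Karger1999, Thm. 2.9 (proof)] -/
theorem sum_rank_le {γ : Type*} [DecidableEq γ] (val : γ → ℕ) (φ : ℕ → ℝ)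
    (hφ : ∀ a b : ℕ, 1 ≤ a → a ≤ b → φ b ≤ φ a) (A : Finset γ) :
    ∑ S ∈ A, φ ((A.filter fun S' => val S' ≤ val S).card)
      ≤ ∑ k ∈ Ioc 0 A.card, φ k := by
  induction A using Finset.induction_on_max_value val with
  | empty => simp
  | insert a s has hmax ih =>
    rw [Finset.sum_insert has, Finset.card_insert_of_notMem has,
      Finset.sum_Ioc_succ_top (Nat.zero_le _)]
    have hra : ((insert a s).filter fun S' => val S' ≤ val a).card = s.card + 1 := by
      have : (insert a s).filter (fun S' => val S' ≤ val a) = insert a s := by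
        refine Finset.filter_true_of_mem fun x hx => ?_
        rcases Finset.mem_insert.1 hx with rfl | hx
        · exact le_rfl
        · exact hmax x hx
      rw [this, Finset.card_insert_of_notMem has]
    rw [hra]
    have hrest : ∑ x ∈ s, φ (((insert a s).filter fun S' => val S' ≤ val x).card)
        ≤ ∑ x ∈ s, φ ((s.filter fun S' => val S' ≤ val x).card) := by
      refine Finset.sum_le_sum fun x hx => hφ _ _ ?_ ?_
      · exact Finset.card_pos.2 ⟨x, Finset.mem_filter.2 ⟨hx, le_rfl⟩⟩
      · exact Finset.card_le_card
          (Finset.filter_subset_filter _ (Finset.subset_insert a s))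
    linarith

/-! ### The failure probability of one cut, and the union over cuts -/

/-- The two sides of a cut define the same failure event. [cite: Karger1999, §2 (cut failure)] -/
theorem cutFails_compl {n : ℕ} (S : Finset (Fin n)) : cutFails Sᶜ = cutFails S := by
  ext ω
  simp only [mem_cutFails_iff, compl_compl]
  constructor
  · intro h x hx y hy; rw [Sym2.eq_swap]; exact h y hy x hx
  · intro h x hx y hy; rw [Sym2.eq_swap]; exact h y hy x hx

/-- **A cut of value `v` fails with probability `p^v`** in the bundle model (independence of the
parallel edges; Karger 1999, proof of Thm. 2.9: "let `p_k = p^{c_k}` be the probability that all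
edges in the `k`-th cut fail"). [cite: Karger1999, Thm. 2.9 (proof)] -/
theorem prodBernoulli_real_cutFails {n : ℕ} (m : Sym2 (Fin n) → ℕ) (p : unitInterval)
    (S : Finset (Fin n)) :
    (prodBernoulli (bundleOpenWeight m p)).real (cutFails S)
      = (p : ℝ) ^ multigraphCutValue m S := by
  classical
  set F : Finset (Sym2 (Fin n)) := (S ×ˢ Sᶜ).image fun q => s(q.1, q.2) with hF
  have hset : cutFails S = {ω | ∀ e ∈ F, e ∉ ω} := by
    ext ω
    simp only [mem_cutFails_iff, Set.mem_setOf_eq, hF, Finset.mem_image, Finset.mem_product]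
    constructor
    · rintro h e ⟨⟨x, y⟩, ⟨hx, hy⟩, rfl⟩
      exact h x hx y hy
    · intro h x hx y hy
      exact h _ ⟨(x, y), ⟨hx, hy⟩, rfl⟩
  rw [hset, prodBernoulli_real_forall_notMem]
  have h1 : ∏ e ∈ F, (1 - (bundleOpenWeight m p e : ℝ)) = ∏ e ∈ F, (p : ℝ) ^ (m e) :=
    Finset.prod_congr rfl fun e _ => by rw [coe_bundleOpenWeight]; ring
  rw [h1, Finset.prod_pow_eq_pow_sum]
  congr 1
  have hinj : Set.InjOn (fun q : Fin n × Fin n => s(q.1, q.2)) ↑(S ×ˢ Sᶜ) := by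
    rintro ⟨x, y⟩ hq ⟨x', y'⟩ hq' h
    have hq1 : x ∈ S ∧ y ∉ S := by simpa using hq
    have hq2 : x' ∈ S ∧ y' ∉ S := by simpa using hq'
    have h' : s(x, y) = s(x', y') := h
    rcases Sym2.eq_iff.1 h' with ⟨h1, h2⟩ | ⟨h1, h2⟩
    · rw [h1, h2]
    · exact absurd (h1 ▸ hq1.1) hq2.2
  rw [hF, Finset.sum_image hinj, multigraphCutValue, Finset.sum_product]

/-- Union bound over ANCHORED cuts: the event "some cut with the (complement-symmetric) property
`P` fails" is the union of `cutFails S` over the cuts `S ∋ v`, so its probability is at most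
`Σ_{S ∋ v, Sᶜ ≠ ∅, P S} p^{value S}` (Karger 1999, proof of Thm. 2.9: "we bound the failure
probability by summing the probabilities that each cut fails"). [cite: Karger1999, Thm. 2.9 (proof)] -/
theorem real_exists_cutFails_le_sum {n : ℕ} (m : Sym2 (Fin n) → ℕ) (p : unitInterval) (v : Fin n)
    (P : Finset (Fin n) → Prop) [DecidablePred P] (hP : ∀ S, P S → P Sᶜ) :
    (prodBernoulli (bundleOpenWeight m p)).real
        {ω | ∃ S : Finset (Fin n), S.Nonempty ∧ Sᶜ.Nonempty ∧ P S ∧ ω ∈ cutFails S}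
      ≤ ∑ S ∈ Finset.univ.filter (fun S : Finset (Fin n) => v ∈ S ∧ Sᶜ.Nonempty ∧ P S),
          (p : ℝ) ^ multigraphCutValue m S := by
  classical
  have hU : {ω | ∃ S : Finset (Fin n), S.Nonempty ∧ Sᶜ.Nonempty ∧ P S ∧ ω ∈ cutFails S}
      ⊆ ⋃ S ∈ Finset.univ.filter (fun S : Finset (Fin n) => v ∈ S ∧ Sᶜ.Nonempty ∧ P S),
          cutFails S := by
    rintro ω ⟨S, hS, hSc, hPS, hω⟩
    simp only [Set.mem_iUnion, Finset.mem_filter, Finset.mem_univ, true_and, exists_prop]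
    by_cases hv : v ∈ S
    · exact ⟨S, ⟨hv, hSc, hPS⟩, hω⟩
    · refine ⟨Sᶜ, ⟨Finset.mem_compl.2 hv, by simpa using hS, hP S hPS⟩, ?_⟩
      rwa [cutFails_compl]
  calc (prodBernoulli (bundleOpenWeight m p)).real
        {ω | ∃ S : Finset (Fin n), S.Nonempty ∧ Sᶜ.Nonempty ∧ P S ∧ ω ∈ cutFails S}
      ≤ (prodBernoulli (bundleOpenWeight m p)).real
          (⋃ S ∈ Finset.univ.filter (fun S : Finset (Fin n) => v ∈ S ∧ Sᶜ.Nonempty ∧ P S),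
            cutFails S) := measureReal_mono hU (measure_ne_top _ _)
    _ ≤ ∑ S ∈ Finset.univ.filter (fun S : Finset (Fin n) => v ∈ S ∧ Sᶜ.Nonempty ∧ P S),
          (prodBernoulli (bundleOpenWeight m p)).real (cutFails S) :=
        measureReal_biUnion_finset_le _ _
    _ = _ := Finset.sum_congr rfl fun S _ => prodBernoulli_real_cutFails m p S

/-! ### Theorem 2.9 from Theorem 2.6 -/

/-- **The sum over anchored cuts of value `≥ αc` of `p^{value}` is at most `n^{-αδ}(1 + 2/δ)`**
(Karger 1999, proof of Thm. 2.9, given the cut-counting Thm. 2.6): with `p^c = n^{-(2+δ)}`, a cut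
of value `v ≥ αc` has `p^v ≤ (p^c)^α = N^{-s}` (`N = n^{2α}`, `s = 1 + δ/2`), and the cut of rank
`k` (in increasing order of value) has `p^v < k^{-s}` because fewer than `n^{2v/c}` cuts have value
`≤ v`; then `Σ_k min(N^{-s}, k^{-s}) ≤ N^{1-s}(1 + 1/(s-1))`. [cite: Karger1999, Thm. 2.9 (proof)] -/
theorem sum_anchored_pow_le (hcc : Karger1999_cutCounting) {n : ℕ} (m : Sym2 (Fin n) → ℕ)
    (v : Fin n) {c : ℕ} {p : unitInterval} {δ α : ℝ} (hc1 : 1 ≤ c) (hδ : 0 < δ) (hα : 1 ≤ α)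
    (hp0 : 0 < (p : ℝ)) (hp1 : (p : ℝ) < 1)
    (hcut : ∀ S : Finset (Fin n), S.Nonempty → Sᶜ.Nonempty → c ≤ multigraphCutValue m S)
    (hpc : (p : ℝ) ^ c = (n : ℝ) ^ (-(2 + δ))) :
    ∑ S ∈ Finset.univ.filter (fun S : Finset (Fin n) =>
        v ∈ S ∧ Sᶜ.Nonempty ∧ α * c ≤ (multigraphCutValue m S : ℝ)),
        (p : ℝ) ^ multigraphCutValue m S ≤ (n : ℝ) ^ (-(α * δ)) * (1 + 2 / δ) := by
  classical
  have hn1 : 1 ≤ n := Fin.pos v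
  have hn0 : (0 : ℝ) < n := by exact_mod_cast hn1
  have hc0 : (0 : ℝ) < c := by exact_mod_cast hc1
  set s : ℝ := 1 + δ / 2 with hs
  have hs1 : 1 < s := by rw [hs]; linarith
  set A : Finset (Finset (Fin n)) := Finset.univ.filter fun S => v ∈ S ∧ Sᶜ.Nonempty with hA
  have hcutR : ∀ S : Finset (Fin n), S.Nonempty → Sᶜ.Nonempty →
      (c : ℝ) ≤ (multigraphCutValue m S : ℝ) :=
    fun S h1 h2 => by exact_mod_cast hcut S h1 h2
  -- `p^{value S} = (p^c)^{value S / c}`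
  have hpv : ∀ S : Finset (Fin n), (p : ℝ) ^ multigraphCutValue m S
      = ((p : ℝ) ^ c) ^ ((multigraphCutValue m S : ℝ) / c) := by
    intro S
    rw [← Real.rpow_natCast (p : ℝ) c, ← Real.rpow_mul hp0.le, ← Real.rpow_natCast]
    congr 1
    field_simp
  -- (a) `p^{value S} ≤ (rank S)^{-s}` for anchored cuts, by cut counting at `α' = value S / c`
  have ha : ∀ S ∈ A, (p : ℝ) ^ multigraphCutValue m S
      ≤ ((A.filter fun S' => multigraphCutValue m S' ≤ multigraphCutValue m S).card : ℝ)
          ^ (-s) := by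
    intro S hS
    have hS' : v ∈ S ∧ Sᶜ.Nonempty := by simpa [hA] using hS
    set α' : ℝ := (multigraphCutValue m S : ℝ) / c with hα'
    have hvS : (c : ℝ) ≤ multigraphCutValue m S := hcutR S ⟨v, hS'.1⟩ hS'.2
    have hα'1 : 1 ≤ α' := by rw [hα', le_div_iff₀ hc0]; linarith
    have hcount := hcc n m v (c : ℝ) α' hc0 hα'1 hcutR
    have hfam : (Finset.univ.filter fun S' : Finset (Fin n) =>
        v ∈ S' ∧ S'ᶜ.Nonempty ∧ (multigraphCutValue m S' : ℝ) ≤ α' * c)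
        = A.filter fun S' => multigraphCutValue m S' ≤ multigraphCutValue m S := by
      rw [hA, Finset.filter_filter]
      refine Finset.filter_congr fun S' _ => ?_
      have e : α' * c = (multigraphCutValue m S : ℝ) := by rw [hα']; field_simp
      rw [e, Nat.cast_le, and_assoc]
    rw [hfam] at hcount
    have hgpos : (0 : ℝ) <
        ((A.filter fun S' => multigraphCutValue m S' ≤ multigraphCutValue m S).card : ℝ) := by
      have : 0 < (A.filter fun S' => multigraphCutValue m S' ≤ multigraphCutValue m S).card :=
        Finset.card_pos.2 ⟨S, Finset.mem_filter.2 ⟨hS, le_rfl⟩⟩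
      exact_mod_cast this
    have hpS : (p : ℝ) ^ multigraphCutValue m S = ((n : ℝ) ^ (2 * α')) ^ (-s) := by
      rw [hpv S, hpc, ← Real.rpow_mul hn0.le, ← Real.rpow_mul hn0.le]
      congr 1
      rw [hs]; ring
    rw [hpS]
    exact (Real.rpow_lt_rpow_of_neg hgpos hcount (by linarith)).le
  -- (b) `p^{value S} ≤ N^{-s}` when `value S ≥ α c`
  set N : ℝ := (n : ℝ) ^ (2 * α) with hN
  have hN1 : 1 ≤ N := Real.one_le_rpow (by exact_mod_cast hn1) (by linarith)
  have hb : ∀ S : Finset (Fin n), α * c ≤ (multigraphCutValue m S : ℝ) →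
      (p : ℝ) ^ multigraphCutValue m S ≤ N ^ (-s) := by
    intro S hαS
    have hpc1 : (p : ℝ) ^ c ≤ 1 := pow_le_one₀ hp0.le hp1.le
    have hpc0 : 0 < (p : ℝ) ^ c := pow_pos hp0 c
    have hexp : α ≤ (multigraphCutValue m S : ℝ) / c := by rw [le_div_iff₀ hc0]; exact hαS
    calc (p : ℝ) ^ multigraphCutValue m S
        = ((p : ℝ) ^ c) ^ ((multigraphCutValue m S : ℝ) / c) := hpv S
      _ ≤ ((p : ℝ) ^ c) ^ α := Real.rpow_le_rpow_of_exponent_ge hpc0 hpc1 hexp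
      _ = N ^ (-s) := by
          rw [hpc, ← Real.rpow_mul hn0.le, hN, ← Real.rpow_mul hn0.le]
          congr 1
          rw [hs]; ring
  -- (c) majorise by `Σ_k min(N^{-s}, k^{-s})`
  set φ : ℕ → ℝ := fun k => min (N ^ (-s)) ((k : ℝ) ^ (-s)) with hφ
  have hφanti : ∀ a b : ℕ, 1 ≤ a → a ≤ b → φ b ≤ φ a := by
    intro a b ha hab
    have : ((b : ℝ)) ^ (-s) ≤ (a : ℝ) ^ (-s) :=
      Real.rpow_le_rpow_of_nonpos (by exact_mod_cast ha) (by exact_mod_cast hab) (by linarith)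
    exact min_le_min le_rfl this
  have hsub : (Finset.univ.filter fun S : Finset (Fin n) =>
      v ∈ S ∧ Sᶜ.Nonempty ∧ α * c ≤ (multigraphCutValue m S : ℝ)) ⊆ A := by
    intro S hS
    simp only [Finset.mem_filter, Finset.mem_univ, true_and] at hS
    simpa [hA] using And.intro hS.1 hS.2.1
  calc ∑ S ∈ Finset.univ.filter (fun S : Finset (Fin n) =>
          v ∈ S ∧ Sᶜ.Nonempty ∧ α * c ≤ (multigraphCutValue m S : ℝ)),
          (p : ℝ) ^ multigraphCutValue m S
      ≤ ∑ S ∈ Finset.univ.filter (fun S : Finset (Fin n) =>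
          v ∈ S ∧ Sᶜ.Nonempty ∧ α * c ≤ (multigraphCutValue m S : ℝ)),
          φ ((A.filter fun S' => multigraphCutValue m S' ≤ multigraphCutValue m S).card) := by
        refine Finset.sum_le_sum fun S hS => ?_
        have hS' := hS
        simp only [Finset.mem_filter, Finset.mem_univ, true_and] at hS'
        exact le_min (hb S hS'.2.2) (ha S (hsub hS))
    _ ≤ ∑ S ∈ A, φ ((A.filter fun S' => multigraphCutValue m S' ≤ multigraphCutValue m S).card) :=
        Finset.sum_le_sum_of_subset_of_nonneg hsub fun S _ _ =>
          le_min (Real.rpow_nonneg (by linarith) _) (Real.rpow_nonneg (by positivity) _)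
    _ ≤ ∑ k ∈ Ioc 0 A.card, φ k := sum_rank_le _ φ hφanti A
    _ ≤ N ^ (1 - s) * (1 + 1 / (s - 1)) := sum_min_rpow_le hN1 hs1 _
    _ = (n : ℝ) ^ (-(α * δ)) * (1 + 2 / δ) := by
        have e1 : N ^ (1 - s) = (n : ℝ) ^ (-(α * δ)) := by
          rw [hN, ← Real.rpow_mul hn0.le]
          congr 1
          rw [hs]; ring
        have e2 : 1 / (s - 1) = 2 / δ := by
          rw [hs]
          field_simp
          ring_nf
          field_simp
        rw [e1, e2]

/-- **Theorem 2.9 from Theorem 2.6** (Karger 1999): the large-cut failure bound follows from cut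
counting by the union bound over cuts sorted by value. [cite: Karger1999, Thm. 2.9 (proof)] -/
theorem largeCutFailure_of_cutCounting (hcc : Karger1999_cutCounting) :
    Karger1999_largeCutFailure := by
  intro n m c p δ α hc1 hδ hα hp0 hp1 hcut hmin hpc
  classical
  obtain ⟨S₀, hS₀, -, -⟩ := hmin
  obtain ⟨v, -⟩ := hS₀
  -- the bound (ii) for every `α' ≥ 1`
  have hgen : ∀ α' : ℝ, 1 ≤ α' →
      (prodBernoulli (bundleOpenWeight m p)).real
          {ω | ∃ S : Finset (Fin n), S.Nonempty ∧ Sᶜ.Nonempty ∧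
              α' * c ≤ (multigraphCutValue m S : ℝ) ∧ ω ∈ cutFails S}
        ≤ (n : ℝ) ^ (-(α' * δ)) * (1 + 2 / δ) := by
    intro α' hα'
    have h := real_exists_cutFails_le_sum m p v
      (fun S : Finset (Fin n) => α' * c ≤ (multigraphCutValue m S : ℝ))
      (fun S hS => by simpa [multigraphCutValue_compl] using hS)
    exact h.trans (sum_anchored_pow_le hcc m v hc1 hδ hα' hp0 hp1 hcut hpc)
  refine ⟨?_, hgen α hα⟩
  -- (i): every cut has value `≥ 1·c`
  have hmono : {ω | ∃ S : Finset (Fin n), S.Nonempty ∧ Sᶜ.Nonempty ∧ ω ∈ cutFails S}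
      ⊆ {ω | ∃ S : Finset (Fin n), S.Nonempty ∧ Sᶜ.Nonempty ∧
          (1 : ℝ) * c ≤ (multigraphCutValue m S : ℝ) ∧ ω ∈ cutFails S} := by
    rintro ω ⟨S, h1, h2, h3⟩
    refine ⟨S, h1, h2, ?_, h3⟩
    rw [one_mul]
    exact_mod_cast hcut S h1 h2
  calc (prodBernoulli (bundleOpenWeight m p)).real
        {ω | ∃ S : Finset (Fin n), S.Nonempty ∧ Sᶜ.Nonempty ∧ ω ∈ cutFails S}
      ≤ (prodBernoulli (bundleOpenWeight m p)).real
          {ω | ∃ S : Finset (Fin n), S.Nonempty ∧ Sᶜ.Nonempty ∧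
            (1 : ℝ) * c ≤ (multigraphCutValue m S : ℝ) ∧ ω ∈ cutFails S} :=
        measureReal_mono hmono (measure_ne_top _ _)
    _ ≤ (n : ℝ) ^ (-(1 * δ)) * (1 + 2 / δ) := hgen 1 le_rfl
    _ = (n : ℝ) ^ (-δ) * (1 + 2 / δ) := by rw [one_mul]


end Karger1999

/-- **Large cuts rarely fail, proved** (Karger 1999, Thm. 2.9): with minimum cut `c ≥ 1` and
`p^c = n^{-(2+δ)}`, (i) `P(some cut fails) ≤ n^{-δ}(1 + 2/δ)` and (ii) `P(some cut of value ≥ αc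
fails) ≤ n^{-αδ}(1 + 2/δ)` for every real `α ≥ 1`, in the bundle model
`prodBernoulli (bundleOpenWeight m p)`. Discharges the named fact `Karger1999_largeCutFailure`
from the proved cut-counting theorem `Karger1999_cutCounting_holds`. [cite: Karger1999, Thm. 2.9] -/
theorem Karger1999_largeCutFailure_holds : Karger1999_largeCutFailure :=
  Karger1999.largeCutFailure_of_cutCounting Karger1999_cutCounting_holds

end Literature.Probability.Percolation

end
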